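import Mathlib
import Literature.Analysis.FluidPDE.TorusLpOperatorFacts
import Literature.Analysis.FluidPDE.TorusClassicalH1Balance
import Literature.Analysis.FunctionSpaces.TorusCalculusProofs
import HarnessLib

/-!
# «ℙ drops on divergence-free test fields» — D2-CHAIN-MAP step S7, the last prose sentence (cap g6, cell `ns-blowup`, 2026-08-26)

HONEST FRAMING (human ruling D-0035): nothing here is a claim about Navier–Stokes blow-up.
WHAT THIS IS NOT: not NS evidence. The tail theorems of the cell's certificates
(`AbcFlowCubeTailForms`, `AbcFlowL2TailForm`, `AbcFlowH1TailForm`, `SharpH2TailDissipativity`) are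
stated for the operator `νΔ − [(U·∇)· + (·∇)U]` WITHOUT the Leray–Helmholtz projector `ℙ`, while the
MODEL operator is `A = νℙΔ − ℙ[(U·∇)· + (·∇)U]`. The sentence that licenses this — «`ℙ` drops when
the form is paired with a divergence-free test field (`w`, `Δw`, `Δ²w`)» (D2-CHAIN-MAP S7; `d2_cert.py`
docstring; INSTAB-BRIDGE §11 l.107) — was recorded as a CITATION of the tree lemma
`Torus.integral_inner_gradient_eq_zero_of_isDivFree`. This file makes it a theorem about the tree's
smooth Leray–Helmholtz projector `Literature.Analysis.FluidPDE.Torus.lerayHelmholtz`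
(`ℙ f = f − ∇Δ⁻¹ div f`, `TorusLpOperatorFacts`):

* `integral_inner_lerayHelmholtz_eq_of_isDivFree` — for smooth divergence-free `v` and smooth `f`:
  `∫⟪v, ℙ f⟫ = ∫⟪v, f⟫` (and `integral_inner_lerayHelmholtz_left_eq_of_isDivFree`: `∫⟪ℙ f, v⟫ = ∫⟪f, v⟫`);
* `integral_inner_laplacian_lerayHelmholtz_eq` — `∫⟪Δw, ℙ f⟫ = ∫⟪Δw, f⟫` for smooth divergence-free
  `w` (the `H¹`-level pairing, `Δw` divergence free by `Torus.IsDivFree.laplacian_of_isSmooth`);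
* `integral_inner_bilaplacian_lerayHelmholtz_eq` — `∫⟪Δ²w, ℙ f⟫ = ∫⟪Δ²w, f⟫` (the `H²`-level
  pairing of the D2 tail, §11 l.107 «⟨Δ²w, ℙf⟩ = ⟨Δ²w, f⟩»).

So, after this file, the D2 referee-read list (i) is: S4 (c) (the script's own ball Gershgorin test)
and S9 (generation, semigroup reading only). Tree lemmas only; no new definitions; std axioms.
-/

noncomputable section

namespace Summit.NavierStokesRegularity.FluidComputer.LerayProjectionDivFreePairing

open Literature.Analysis.FluidPDE Literature.Analysis.FunctionSpaces
open Literature.Analysis.FunctionSpaces.Torus MeasureTheory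
open scoped RealInnerProductSpace

variable {d : Type*} [Fintype d] [DecidableEq d]

/-- **`ℙ` drops against a divergence-free field (right slot).** For smooth divergence-free `v` and
smooth `f` on `𝕋^d`: `∫⟪v, ℙ f⟫ = ∫⟪v, f⟫`, where `ℙ f = f − ∇Δ⁻¹ div f` is the tree's smooth
Leray–Helmholtz projector — because `∫⟪v, ∇φ⟫ = 0` (`integral_inner_gradient_eq_zero_of_isDivFree`). -/
theorem integral_inner_lerayHelmholtz_eq_of_isDivFree {v f : UnitAddTorus d → EuclideanSpace ℝ d}
    (hv : IsSmooth v) (hdiv : IsDivFree v) (hf : IsSmooth f) :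
    ∫ x, ⟪v x, Torus.lerayHelmholtz f x⟫ = ∫ x, ⟪v x, f x⟫ := by
  have hφ : IsSmooth (invLaplacian (Torus.divergence f)) := isSmooth_invLaplacian hf.divergence
  have hi1 : Integrable (fun x => ⟪v x, f x⟫) volume :=
    ((hv.continuous).inner hf.continuous).integrable_of_hasCompactSupport
      (HasCompactSupport.of_compactSpace _)
  have hi2 : Integrable (fun x => ⟪v x, Torus.gradient (invLaplacian (Torus.divergence f)) x⟫) volume :=
    ((hv.continuous).inner hφ.gradient.continuous).integrable_of_hasCompactSupport
      (HasCompactSupport.of_compactSpace _)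
  have hgrad : ∫ x, ⟪v x, Torus.gradient (invLaplacian (Torus.divergence f)) x⟫ = 0 := by
    have h := integral_inner_gradient_eq_zero_of_isDivFree hv hφ hdiv
    have e : (fun x => ⟪v x, Torus.gradient (invLaplacian (Torus.divergence f)) x⟫)
        = fun x => ⟪Torus.gradient (invLaplacian (Torus.divergence f)) x, v x⟫ := by
      funext x; exact real_inner_comm _ _
    rw [e]; exact h
  simp_rw [Torus.lerayHelmholtz_apply, inner_sub_right]
  rw [integral_sub hi1 hi2, hgrad, sub_zero]

/-- **`ℙ` drops against a divergence-free field (left slot):** `∫⟪ℙ f, v⟫ = ∫⟪f, v⟫`. -/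
theorem integral_inner_lerayHelmholtz_left_eq_of_isDivFree {v f : UnitAddTorus d → EuclideanSpace ℝ d}
    (hv : IsSmooth v) (hdiv : IsDivFree v) (hf : IsSmooth f) :
    ∫ x, ⟪Torus.lerayHelmholtz f x, v x⟫ = ∫ x, ⟪f x, v x⟫ := by
  have h := integral_inner_lerayHelmholtz_eq_of_isDivFree hv hdiv hf
  have e1 : (fun x => ⟪Torus.lerayHelmholtz f x, v x⟫) = fun x => ⟪v x, Torus.lerayHelmholtz f x⟫ := by
    funext x; exact real_inner_comm _ _
  have e2 : (fun x => ⟪f x, v x⟫) = fun x => ⟪v x, f x⟫ := by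
    funext x; exact real_inner_comm _ _
  rw [e1, e2]; exact h

/-- **`H¹` level: `∫⟪Δw, ℙ f⟫ = ∫⟪Δw, f⟫`** for smooth divergence-free `w` and smooth `f`
(`Δw` is smooth and divergence free). -/
theorem integral_inner_laplacian_lerayHelmholtz_eq {w f : UnitAddTorus d → EuclideanSpace ℝ d}
    (hw : IsSmooth w) (hdiv : IsDivFree w) (hf : IsSmooth f) :
    ∫ x, ⟪laplacian w x, Torus.lerayHelmholtz f x⟫ = ∫ x, ⟪laplacian w x, f x⟫ :=
  integral_inner_lerayHelmholtz_eq_of_isDivFree hw.laplacian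
    (Literature.Analysis.FluidPDE.Torus.IsDivFree.laplacian_of_isSmooth hw hdiv) hf

/-- **`H²` level (the D2 tail pairing, INSTAB-BRIDGE §11 l.107): `∫⟪Δ²w, ℙ f⟫ = ∫⟪Δ²w, f⟫`** for
smooth divergence-free `w` and smooth `f`. -/
theorem integral_inner_bilaplacian_lerayHelmholtz_eq {w f : UnitAddTorus d → EuclideanSpace ℝ d}
    (hw : IsSmooth w) (hdiv : IsDivFree w) (hf : IsSmooth f) :
    ∫ x, ⟪laplacian (laplacian w) x, Torus.lerayHelmholtz f x⟫
      = ∫ x, ⟪laplacian (laplacian w) x, f x⟫ :=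
  integral_inner_lerayHelmholtz_eq_of_isDivFree hw.laplacian.laplacian
    (Literature.Analysis.FluidPDE.Torus.IsDivFree.laplacian_of_isSmooth hw.laplacian
      (Literature.Analysis.FluidPDE.Torus.IsDivFree.laplacian_of_isSmooth hw hdiv)) hf

end Summit.NavierStokesRegularity.FluidComputer.LerayProjectionDivFreePairing

end
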